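import Mathlib
import Summits.NavierStokesRegularity.OSWSelfSimilar.SheetNSLineTorusCascadeMajorant
import Summits.NavierStokesRegularity.OSWSelfSimilar.SheetNSLineTorusCascadeExistence
import HarnessLib

/-!
# Viscous CLM on the torus (`a = 0`, `σ = 2`): the nonnegative cascade is MONOTONE IN THE DATUM, hence EVERY
# nonnegative-coefficient datum with first mode `a₁ ≥ 48ν` blows up (coefficient level)

HONEST FRAMING (cell ns-blowup GROUP B «PROFILE SEARCH», zone Z3, row Z3-U addendum A-F2 of `HOME/profile/z3/CENSUS-Z3.md`;
human rulings D-0035/D-0074): **1-D MODEL (viscous Constantin–Lax–Majda equation on `𝕋`); ODE calculus on Fourier-coefficient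
families `IsNonnegCascade` (data `ω₀` whose analytic signal `Hω₀ − iω₀ = Σ_{k≥1} a_k e^{ikx}` has `a_k ≥ 0`), kernel-checked;
not Euler, not Navier–Stokes; «violates: none — MODEL».**

The sine-datum theorems (`unbounded_of_le`: `c ≥ 48ν` ⇒ coefficients unbounded at `t = log 2/ν`, p498092; the certified
constants through eng-5's plugs) extend to GENERAL nonnegative data by a comparison principle: the cascade
`ċ_k = ½Σ_{i+j=k} c_i c_j − νk²c_k` preserves the order of nonnegative data (this is `IsComplexCascade.norm_le_majorant`,
p500969, read with a real nonnegative minorant). Contents: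

* `IsNonnegCascade.isComplexCascade_ofReal` — a real nonnegative cascade, viewed in `ℂ`, is an `IsComplexCascade`;
* **`IsNonnegCascade.le_of_datum_le`** — comparison principle: two nonnegative cascades with `e₁ k 0 ≤ e₂ k 0` for all `k` satisfy
  `e₁ k t ≤ e₂ k t` for all `k`, `t ≥ 0`;
* **`IsNonnegCascade.sine_le`** — the sine cascade with `c = e 1 0` lies below `e`;
* **`IsNonnegCascade.unbounded_of_le`** — `0 < ν`, `48ν ≤ e 1 0` ⇒ `k ↦ e k (log 2/ν)` is unbounded (blow-up for EVERY
  nonnegative-coefficient datum whose first mode is large — not only `−c sin x`);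
* **`IsNonnegCascade.unbounded_of_sine_unbounded`** — transfer slot: unboundedness of the explicit sine cascade
  `cascadeSolution ν (sineDatum (e 1 0))` at a time `τ` (what a certificate proves, for `e 1 0` above the certified constant)
  ⇒ unboundedness of `e` at `τ`.

bears_on: LADDER-NS N5 / zone Z3 (row Z3-U, A-F2) → N1 linear core. WHAT THIS IS NOT: not NS; coefficient level only (the PDE
link `SheetNSLineTorusCascadeLink*` is typed for the sine datum); data with coefficients of both signs are not covered.
-/

noncomputable section

namespace Summit.NavierStokesRegularity.OSWSelfSimilar
namespace SheetNSLineTorusCascade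

open Finset Real Set Filter MeasureTheory Complex

variable {ν : ℝ} {e e₁ e₂ : ℕ → ℝ → ℝ}

/-- A real nonnegative cascade, coerced to `ℂ`, is a complex cascade. [new here — MODEL] -/
theorem IsNonnegCascade.isComplexCascade_ofReal (he : IsNonnegCascade ν e) :
    IsComplexCascade ν (fun k t => ((e k t : ℝ) : ℂ)) where
  zero t := by simp [he.zero t]
  cont k := Complex.continuous_ofReal.comp_continuousOn (he.cont k)
  ode k t ht := by
    have h := (he.ode k t ht).ofReal_comp
    refine h.congr_deriv ?_
    push_cast
    ring

/-- **Comparison principle.** Two nonnegative cascades with ordered data stay ordered: `e₁ k 0 ≤ e₂ k 0` for all `k` ⇒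
`e₁ k t ≤ e₂ k t` for all `k` and `t ≥ 0`. [new here — MODEL] -/
theorem IsNonnegCascade.le_of_datum_le (h₁ : IsNonnegCascade ν e₁) (h₂ : IsNonnegCascade ν e₂)
    (h0 : ∀ k, e₁ k 0 ≤ e₂ k 0) : ∀ k : ℕ, ∀ t : ℝ, 0 ≤ t → e₁ k t ≤ e₂ k t := by
  intro k t ht
  have h := IsComplexCascade.norm_le_majorant h₁.isComplexCascade_ofReal h₂ (fun k => by
    rw [Complex.norm_real, Real.norm_of_nonneg (h₁.init_nonneg k)]; exact h0 k) k t ht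
  rwa [Complex.norm_real, Real.norm_of_nonneg (h₁.nonneg k t ht)] at h

/-- **The sine cascade with the same first mode lies below.** For a nonnegative cascade `e`, the explicit sine cascade with
`c = e 1 0` satisfies `cascadeSolution ν (sineDatum (e 1 0)) k t ≤ e k t` (`t ≥ 0`). [new here — MODEL] -/
theorem IsNonnegCascade.sine_le (he : IsNonnegCascade ν e) :
    ∀ k : ℕ, ∀ t : ℝ, 0 ≤ t → cascadeSolution ν (sineDatum (e 1 0)) k t ≤ e k t := by
  have hs := isSineCascade_cascadeSolution ν (e 1 0)
  refine (hs.isNonnegCascade (he.init_nonneg 1)).le_of_datum_le he fun k => ?_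
  rcases Nat.lt_or_ge k 2 with hk | hk
  · interval_cases k
    · rw [hs.zero, he.zero]
    · rw [hs.one_init]
  · rw [hs.init_zero k hk]; exact he.init_nonneg k

/-- **BLOW-UP FOR EVERY NONNEGATIVE-COEFFICIENT DATUM WITH LARGE FIRST MODE.** For `0 < ν` and `48ν ≤ e 1 0` the coefficients
are unbounded at `t = log 2/ν` (comparison with the sine cascade + `unbounded_of_le`). [new here — MODEL] -/
theorem IsNonnegCascade.unbounded_of_le (he : IsNonnegCascade ν e) (hν : 0 < ν) (hc : 48 * ν ≤ e 1 0) :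
    ∀ M : ℝ, ∃ k : ℕ, M < e k (Real.log 2 / ν) := by
  intro M
  obtain ⟨k, hk⟩ := cascadeSolution_sine_unbounded_of_le hν hc M
  exact ⟨k, lt_of_lt_of_le hk (he.sine_le k _ (div_pos (Real.log_pos (by norm_num)) hν).le)⟩

/-- **Transfer slot for certified constants.** If the explicit sine cascade with `c = e 1 0` has coefficients unbounded at a
time `τ ≥ 0` (what a certificate proves above the certified threshold), so does every nonnegative cascade `e` with that first
mode. [new here — MODEL] -/
theorem IsNonnegCascade.unbounded_of_sine_unbounded (he : IsNonnegCascade ν e) {τ : ℝ} (hτ : 0 ≤ τ)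
    (hunb : ∀ M : ℝ, ∃ k : ℕ, M < cascadeSolution ν (sineDatum (e 1 0)) k τ) :
    ∀ M : ℝ, ∃ k : ℕ, M < e k τ := by
  intro M
  obtain ⟨k, hk⟩ := hunb M
  exact ⟨k, lt_of_lt_of_le hk (he.sine_le k τ hτ)⟩

/-- Contrapositive, census form: a nonnegative cascade bounded at `t = log 2/ν` has first mode `< 48ν`. [new here — MODEL] -/
theorem IsNonnegCascade.first_mode_lt_of_bounded (he : IsNonnegCascade ν e) (hν : 0 < ν)
    (hbdd : ∃ M : ℝ, ∀ k : ℕ, e k (Real.log 2 / ν) ≤ M) : e 1 0 < 48 * ν := by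
  by_contra h
  obtain ⟨M, hM⟩ := hbdd
  obtain ⟨k, hk⟩ := he.unbounded_of_le hν (not_lt.mp h) M
  exact absurd (hM k) (not_le.mpr hk)

end SheetNSLineTorusCascade
end Summit.NavierStokesRegularity.OSWSelfSimilar
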